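import Summits.QuantumFields.YangMills.Theorems.SoloBlindClusteringReflected
import Summits.QuantumFields.YangMills.Theorems.BalabanLadderIRColdPressurePincerDefs
import Summits.QuantumFields.YangMills.Theses.BalabanLadder
import HarnessLib

/-!
# Crux `BalabanLadder.IR` (stmt-QuantumFields-19354) ∕ residual `IRnsc`: the target IS reflected antipodal mirror decay
# (ideator ym-ir-idea-14 gen 4, LINE E «antipodal code», part R; helper for stmt-QuantumFields-19354)

HONEST STATUS.  Reflection-positivity bookkeeping only: an EQUIVALENT re-typing of the crux's conclusion `GapInUnits`.
Nothing here proves `BalabanLadder.IR` (19354), `IRcof` (26930), `IRnsc`, `IRsc`, any lattice mass gap, or the Clay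
Yang–Mills problem (R4 = the conditional finite-𝕋⁴ rung `BalabanLadder.UV` only).

THE POINT.  `GapInUnits G r a` — volume-uniform exponential clustering of EVERY pair of species at EVERY separation
`n ≤ S` on the odd tori `2S+1 ≥ 2S₁(β)+1`, rate `c₁ a(β)`, constants uniform in `β ≥ β₂` — is EQUIVALENT, for every
compact `G`, every `r` and every unit map `a → 0`, to its restriction to the REFLECTED MIRROR PAIRS AT THE ANTIPODE:
`c_{ΘA,A}(S; S), c_{A,ΘA}(S; S) ≤ C_A e^{-c₁ a(β) S}` (one species, one separation; `Θ` = site time reflection,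
`SpeciesTimeReflection`).  The non-trivial direction is the in-tree single-torus reduction of the solo-blind rung D8
(`SoloBlind.exists_const_abs_latticeConnectedCorr_le`, parts 8–12: the OS pairing of slab observables is a positive
Hankel kernel along odd separations, log-convexity interpolates between the trivial small-separation bound and the
antipode, OS–Schwarz transfers to mixed pairs), here re-run with the constant made UNIFORM over rates `μ ≤ μ₀`
(`abs_latticeConnectedCorr_le_of_reflected_uniform` — the same proof with `e^{μ₀ N}` in place of `e^{μ N}` in the
constants), which is what uniformity in `β` (rates `μ = c₁ a(β) ≤ c₁` once `a(β) ≤ 1`) requires.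

CONSEQUENCES (all PROVED): `gapInUnits_iff_reflectedAntipodal`; `IR_iff_reflected : Theses.BalabanLadder.IR ↔ IRrefl`;
`IRnsc_iff_reflected : IRnsc ↔ IRnscRefl` — the residual of record N of the reduction census IS «reflected antipodal
mirror decay in floor units for compact simple `G` with `π₁ ≠ 1`»; hence for LINE E: ANTI⁺ (both reflection orders)
⟺ N by name, and the FRAME ∕ ANTICODE seams of `Cruxes/IR/Lines/antipodal_code.lean` are not needed to reach `IRnscCof`
from ANTI⁺ (they remain the purity-side statement «ANTI ⇒ light-multiplet blindness»).

References: K. Osterwalder, E. Seiler, Ann. Phys. 110 (1978) 440 §2; E. Seiler, LNP 159 (1982) Ch. 2 (mechanism,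
folklore); the solo-blind rung D8 files `SoloBlind*` (the tree's typing, reused by name except for the uniform constant).
-/

open MeasureTheory Filter Topology
open Literature.MathematicalPhysics.QuantumFieldTheory Literature.MathematicalPhysics.QuantumLattice
open Summit.QuantumFields.YangMills.Theorems.SoloBlind
open Summit.QuantumFields.YangMills.Cruxes.OSLegsFromFemtoAndGap.DlrCollarTransfer (GapInUnits LowerBounds)
open Summit.QuantumFields.YangMills.Cruxes.IR.ColdPressurePincer (IRnsc)

noncomputable section

namespace Summit.QuantumFields.YangMills.Cruxes.IR.ReflectedAntipodal

variable {G : Type} [Group G] [TopologicalSpace G] [IsTopologicalGroup G] [CompactSpace G]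
  [MeasurableSpace G] [BorelSpace G]

/-! ## §1 The single-torus reduction with a rate-uniform constant -/

/-- Low index: `x ≤ q ≤ (max C 0 + q)(E t)` when `q ≥ 0`, `E t ≥ 1` (as in `SoloBlindClusteringReflected`). -/
private theorem le_K_low' {C q E t x : ℝ} (hq : 0 ≤ q) (hx : x ≤ q) (hEt : 1 ≤ E * t) :
    x ≤ (max C 0 + q) * E * t := by
  have h0 : 0 ≤ max C 0 + q := add_nonneg (le_max_right _ _) hq
  calc x ≤ (max C 0 + q) * 1 := by linarith [le_max_right C 0]
    _ ≤ (max C 0 + q) * (E * t) := mul_le_mul_of_nonneg_left hEt h0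
    _ = (max C 0 + q) * E * t := by ring

/-- Antipode: `x ≤ C p ≤ (max C 0 + q) E p` when `q ≥ 0`, `E ≥ 1`, `p ≥ 0`. -/
private theorem le_K_mid' {C q E p x : ℝ} (hq : 0 ≤ q) (hE : 1 ≤ E) (hp : 0 ≤ p)
    (hx : x ≤ C * p) : x ≤ (max C 0 + q) * E * p := by
  have h0 : 0 ≤ max C 0 + q := add_nonneg (le_max_right _ _) hq
  calc x ≤ C * p := hx
    _ ≤ (max C 0 + q) * 1 * p := by
        apply mul_le_mul_of_nonneg_right _ hp; linarith [le_max_left C 0]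
    _ ≤ (max C 0 + q) * E * p :=
        mul_le_mul_of_nonneg_right (mul_le_mul_of_nonneg_left hE h0) hp

/-- Past the antipode: `x ≤ C p ≤ (max C 0 + q) E (p θ)` when `q ≥ 0`, `E θ ≥ 1`, `p ≥ 0`. -/
private theorem le_K_succ' {C q E p θ x : ℝ} (hq : 0 ≤ q) (hEθ : 1 ≤ E * θ) (hp : 0 ≤ p)
    (hx : x ≤ C * p) : x ≤ (max C 0 + q) * E * (p * θ) := by
  have h0 : 0 ≤ max C 0 + q := add_nonneg (le_max_right _ _) hq
  calc x ≤ C * p := hx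
    _ ≤ (max C 0 + q) * 1 * p := by
        apply mul_le_mul_of_nonneg_right _ hp; linarith [le_max_left C 0]
    _ ≤ (max C 0 + q) * (E * θ) * p :=
        mul_le_mul_of_nonneg_right (mul_le_mul_of_nonneg_left hEθ h0) hp
    _ = (max C 0 + q) * E * (p * θ) := by ring

/-- The rate-uniform constant of the single-torus reduction: for rates `μ ≤ μ₀` the constant of
`SoloBlind.exists_const_abs_latticeConnectedCorr_le` may be taken to be this function of `μ₀` and the data. -/
def Kref (μ₀ CA CB a0 b0 : ℝ) (TA TB' : ℕ) : ℝ :=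
  max (Real.sqrt ((max CA 0 + 2 * (a0 * a0)) * Real.exp (μ₀ * (2 * TA + 1 : ℕ)) *
        ((max CB 0 + 2 * (b0 * b0)) * Real.exp (μ₀ * (2 * TB' + 1 : ℕ)))))
    (2 * (a0 * b0) * Real.exp (μ₀ * (2 * (TA + TB') + 2 : ℕ)))

/-- **Single-torus reduction to the reflected antipodal correlators, constant UNIFORM over rates `0 ≤ μ ≤ μ₀`**
(`β ≥ 0`, every compact `G`, continuous `ρ`): for slab species `A` (`[-T'_A, T_A]`), `B` (`[-T'_B, T_B]`) with sup
norms `a₀, b₀`, on every odd torus `(2S+1)⁴` with `S ≥ 2(T_A+T'_A+T_B+T'_B)+2`, the four reflection correlators at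
the antipode `c_{ΘA,A}(S), c_{A,ΘA}(S) ≤ C_A e^{-μS}`, `c_{ΘB,B}(S), c_{B,ΘB}(S) ≤ C_B e^{-μS}` give
`|c_{A,B}(n; S)| ≤ Kref(μ₀,…) e^{-μ n}` for every `n ≤ S`.  The proof is that of
`SoloBlind.exists_const_abs_latticeConnectedCorr_le` verbatim, with `e^{μ₀ N}` for `e^{μ N}` in the constants. -/
theorem abs_latticeConnectedCorr_le_of_reflected_uniform {N : ℕ} (ρ : G →* Matrix (Fin N) (Fin N) ℂ)
    (hρ : Continuous ρ) {β : ℝ} (hβ : 0 ≤ β) {A B : YMSpecies G} {TA' TA TB' TB : ℕ}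
    (hA : IsSlabSupported TA' TA A) (hB : IsSlabSupported TB' TB B) {a0 b0 : ℝ}
    (ha0 : ∀ U, |A.F U| ≤ a0) (hb0 : ∀ U, |B.F U| ≤ b0) {μ μ₀ : ℝ} (hμ : 0 ≤ μ) (hμ₀ : μ ≤ μ₀)
    (CA CB : ℝ) {S : ℕ} (hS : 2 * (TA + TA' + TB + TB') + 2 ≤ S)
    (hA1 : latticeConnectedCorr ρ β (2 * S + 1) A.timeReflect.F A.F S ≤ CA * Real.exp (-(μ * S)))
    (hA2 : latticeConnectedCorr ρ β (2 * S + 1) A.F A.timeReflect.F S ≤ CA * Real.exp (-(μ * S)))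
    (hB1 : latticeConnectedCorr ρ β (2 * S + 1) B.timeReflect.F B.F S ≤ CB * Real.exp (-(μ * S)))
    (hB2 : latticeConnectedCorr ρ β (2 * S + 1) B.F B.timeReflect.F S ≤ CB * Real.exp (-(μ * S)))
    {n : ℕ} (hn : n ≤ S) :
    |latticeConnectedCorr ρ β (2 * S + 1) A.F B.F n| ≤ Kref μ₀ CA CB a0 b0 TA TB' * Real.exp (-(μ * n)) := by
  have ha0' : ∀ U, |A.timeReflect.F U| ≤ a0 := fun U => by simpa using ha0 (cfgReflect U)
  have hb0' : ∀ U, |B.timeReflect.F U| ≤ b0 := fun U => by simpa using hb0 (cfgReflect U)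
  set KA : ℝ := (max CA 0 + 2 * (a0 * a0)) * Real.exp (μ₀ * (2 * TA + 1 : ℕ)) with hKA
  set KB : ℝ := (max CB 0 + 2 * (b0 * b0)) * Real.exp (μ₀ * (2 * TB' + 1 : ℕ)) with hKB
  have haa : 0 ≤ 2 * (a0 * a0) := mul_nonneg two_pos.le (mul_self_nonneg a0)
  have hbb : 0 ≤ 2 * (b0 * b0) := mul_nonneg two_pos.le (mul_self_nonneg b0)
  have hS1 : 1 ≤ S := by omega
  have hμ₀' : 0 ≤ μ₀ := hμ.trans hμ₀
  -- the ratio `θ = e^{-μ} ∈ (0, 1]`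
  set θ : ℝ := Real.exp (-μ) with hθdef
  have hθ : 0 < θ := Real.exp_pos _
  have hθpow : ∀ j : ℕ, Real.exp (-(μ * j)) = θ ^ j := fun j => by
    rw [hθdef, ← Real.exp_nat_mul]; ring_nf
  have hθS : 0 ≤ θ ^ S := pow_nonneg hθ.le _
  -- `1 ≤ e^{μ₀ N} θ^j` for `j ≤ N`, and `1 ≤ e^{μ₀ N}`
  have hlow : ∀ {j N₁ : ℕ}, j ≤ N₁ → 1 ≤ Real.exp (μ₀ * N₁) * θ ^ j := by
    intro j N₁ hj
    rw [← hθpow, ← Real.exp_add]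
    apply Real.one_le_exp
    have h1 : μ * (j : ℝ) ≤ μ * N₁ := mul_le_mul_of_nonneg_left (by exact_mod_cast hj) hμ
    have h2 : μ * (N₁ : ℝ) ≤ μ₀ * N₁ := mul_le_mul_of_nonneg_right hμ₀ (Nat.cast_nonneg _)
    linarith
  have hE1 : ∀ N₁ : ℕ, (1 : ℝ) ≤ Real.exp (μ₀ * N₁) := fun N₁ =>
    Real.one_le_exp (mul_nonneg hμ₀' (Nat.cast_nonneg _))
  -- the centred torus observables `FA = Â_c∘Θ'` (`[-T_A, T'_A]`-slab), `FB = B̂_c`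
  set FA : GaugeConfig 4 (2 * S + 1) G → ℝ := fun U =>
    toTorusObservable (2 * S + 1) A.F U.negReflect -
      wilsonExpectation ρ β (toTorusObservable (2 * S + 1) A.F) with hFA
  set FB : GaugeConfig 4 (2 * S + 1) G → ℝ := fun U =>
    toTorusObservable (2 * S + 1) B.F U -
      wilsonExpectation ρ β (toTorusObservable (2 * S + 1) B.F) with hFB
  have hAm : Measurable FA :=
    ((A.measurable.comp (measurable_torusLift (2 * S + 1))).comp
      WilsonSiteRP.measurable_negReflect).sub_const _
  have hBm : Measurable FB := (B.measurable.comp (measurable_torusLift (2 * S + 1))).sub_const _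
  have hAb : ∃ C : ℝ, ∀ U, |FA U| ≤ C :=
    ⟨a0 + |wilsonExpectation ρ β (toTorusObservable (2 * S + 1) A.F)|, fun U =>
      (abs_sub _ _).trans (by gcongr; rw [toTorusObservable_apply]; exact ha0 _)⟩
  have hBb : ∃ C : ℝ, ∀ U, |FB U| ≤ C :=
    ⟨b0 + |wilsonExpectation ρ β (toTorusObservable (2 * S + 1) B.F)|, fun U =>
      (abs_sub _ _).trans (by gcongr; rw [toTorusObservable_apply]; exact hb0 _)⟩
  have hAs : DependsOn FA (slabEdges TA TA') :=
    dependsOn_toTorusObservable_negReflect_slab (by omega) (by omega) hS1 A hA _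
  have hBs : DependsOn FB (slabEdges TB' TB) :=
    dependsOn_toTorusObservable_slab (by omega) (by omega) B hB _
  -- the three endpoint bounds for `FA`: indices `2T_A + 1`, `S`, `S + 1`
  have hloA : osPairingSeq ρ β FA FA (2 * TA + 1) ≤ KA * θ ^ (2 * TA + 1) := by
    have h := (le_abs_self _).trans (abs_latticeConnectedCorr_le ρ hρ β S A
      A.timeReflect ha0 ha0' (2 * TA + 1))
    rw [← osPairingSeq_centred_negReflect_eq ρ hρ] at h
    exact le_K_low' haa h (hlow le_rfl)
  have hm0A : osPairingSeq ρ β FA FA S ≤ KA * θ ^ S := by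
    have h := hA2
    rw [hθpow, ← osPairingSeq_centred_negReflect_eq ρ hρ] at h
    exact le_K_mid' haa (hE1 _) hθS h
  have hm1A : osPairingSeq ρ β FA FA (S + 1) ≤ KA * θ ^ (S + 1) := by
    have h := hA1
    rw [hθpow, ← osPairingSeq_centred_negReflect_succ_eq ρ hρ] at h
    have h1 := hlow (N₁ := 2 * TA + 1) (j := 1) (by omega)
    rw [pow_one] at h1
    rw [pow_succ]
    exact le_K_succ' haa h1 hθS h
  -- the three endpoint bounds for `FB`: indices `2T'_B + 1`, `S`, `S + 1`
  have hloB : osPairingSeq ρ β FB FB (2 * TB' + 1) ≤ KB * θ ^ (2 * TB' + 1) := by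
    have h := (le_abs_self _).trans (abs_latticeConnectedCorr_le ρ hρ β S
      B.timeReflect B hb0' hb0 (2 * TB' + 1))
    rw [← osPairingSeq_centred_eq ρ hρ] at h
    exact le_K_low' hbb h (hlow le_rfl)
  have hm0B : osPairingSeq ρ β FB FB S ≤ KB * θ ^ S := by
    have h := hB1
    rw [hθpow, ← osPairingSeq_centred_eq ρ hρ] at h
    exact le_K_mid' hbb (hE1 _) hθS h
  have hm1B : osPairingSeq ρ β FB FB (S + 1) ≤ KB * θ ^ (S + 1) := by
    have h := hB2
    rw [hθpow, ← osPairingSeq_centred_succ_eq ρ hρ] at h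
    have h1 := hlow (N₁ := 2 * TB' + 1) (j := 1) (by omega)
    rw [pow_one] at h1
    rw [pow_succ]
    exact le_K_succ' hbb h1 hθS h
  -- all odd-index diagonal bounds (solo-blind part 9)
  have hoddA : ∀ j, Odd j → 2 * TA + 1 ≤ j → j ≤ S + 1 →
      osPairingSeq ρ β FA FA j ≤ KA * θ ^ j := fun j hj h1 h2 =>
    osPairingSeq_odd_le_of_endpoints ρ rfl hρ hβ hAm hAb hAs (by omega) (by omega) hθ hloA
      hm0A hm1A hj h1 h2
  have hoddB : ∀ j, Odd j → 2 * TB' + 1 ≤ j → j ≤ S + 1 →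
      osPairingSeq ρ β FB FB j ≤ KB * θ ^ j := fun j hj h1 h2 =>
    osPairingSeq_odd_le_of_endpoints ρ rfl hρ hβ hBm hBb hBs (by omega) (by omega) hθ hloB
      hm0B hm1B hj h1 h2
  -- conclude: OS Schwarz for `n ≥ 2(T_A + T'_B) + 2`, the trivial bound below
  rw [hθpow]
  have hθn : 0 ≤ θ ^ n := pow_nonneg hθ.le _
  by_cases hnA : 2 * (TA + TB') + 2 ≤ n
  · have hmix := osPairingSeq_mixed_abs_le ρ rfl hρ hβ hAm hAb hAs hBm hBb hBs (by omega)
      (by omega) hθ hoddA hoddB (n := n) (by omega) (by omega) hn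
    rw [latticeConnectedCorr_eq_osPairingSeq ρ hρ]
    exact hmix.trans (mul_le_mul_of_nonneg_right (le_max_left _ _) hθn)
  · push Not at hnA
    have hsmall := abs_latticeConnectedCorr_le ρ hρ β S A B ha0 hb0 n
    have hab : 0 ≤ 2 * (a0 * b0) := (abs_nonneg _).trans hsmall
    have h1 := hlow (N₁ := 2 * (TA + TB') + 2) (j := n) (by omega)
    calc |latticeConnectedCorr ρ β (2 * S + 1) A.F B.F n|
        ≤ 2 * (a0 * b0) := hsmall
      _ ≤ 2 * (a0 * b0) * (Real.exp (μ₀ * (2 * (TA + TB') + 2 : ℕ)) * θ ^ n) :=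
          le_mul_of_one_le_right hab h1
      _ = 2 * (a0 * b0) * Real.exp (μ₀ * (2 * (TA + TB') + 2 : ℕ)) * θ ^ n := by ring
      _ ≤ Kref μ₀ CA CB a0 b0 TA TB' * θ ^ n :=
          mul_le_mul_of_nonneg_right (le_max_right _ _) hθn

/-! ## §2 `GapInUnits` ⟺ reflected antipodal mirror decay (every compact `G`) -/

section Units
variable (G) (r : LatticeRep G) (a : ℝ → ℝ)

/-- **Reflected antipodal mirror decay in the unit `a`** (one species, one separation): a rate `c₁ > 0`, a threshold
`β₂`, sizes `S₁(β)`, and per species a constant `C_A`, such that for `β ≥ β₂`, `S ≥ S₁(β)` both reflection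
correlators of `A` at the ANTIPODE of the odd torus `2S+1` obey `c_{ΘA,A}(S; S), c_{A,ΘA}(S; S) ≤ C_A e^{-c₁ a(β) S}`.
It is the restriction of `GapInUnits G r a` to the pairs `(ΘA, A)`, `(A, ΘA)` at `n = S` (`reflectedAntipodal_of_gapInUnits`). -/
def ReflectedAntipodalDecay : Prop :=
  ∃ (c₁ β₂ : ℝ) (S₁ : ℝ → ℕ), 0 < c₁ ∧ ∀ A : YMSpecies G, ∃ C : ℝ, ∀ β : ℝ, β₂ ≤ β → ∀ S : ℕ, S₁ β ≤ S →
    latticeConnectedCorr r.ρ β (2 * S + 1) A.timeReflect.F A.F S ≤ C * Real.exp (-(c₁ * a β * S)) ∧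
      latticeConnectedCorr r.ρ β (2 * S + 1) A.F A.timeReflect.F S ≤ C * Real.exp (-(c₁ * a β * S))

end Units

section Equivalence
variable {r : LatticeRep G} {a : ℝ → ℝ}

/-- The trivial direction: volume-uniform clustering of all pairs contains reflected antipodal mirror decay. -/
theorem reflectedAntipodal_of_gapInUnits (h : GapInUnits G r a) : ReflectedAntipodalDecay G r a := by
  obtain ⟨c₁, β₂, S₁, hc₁, hAB⟩ := h
  refine ⟨c₁, β₂, S₁, hc₁, fun A => ?_⟩
  obtain ⟨C₁, hC₁⟩ := hAB A.timeReflect A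
  obtain ⟨C₂, hC₂⟩ := hAB A A.timeReflect
  refine ⟨max C₁ C₂, fun β hβ S hS => ⟨?_, ?_⟩⟩
  · exact ((le_abs_self _).trans (hC₁ β hβ S S hS le_rfl)).trans
      (mul_le_mul_of_nonneg_right (le_max_left _ _) (Real.exp_pos _).le)
  · exact ((le_abs_self _).trans (hC₂ β hβ S S hS le_rfl)).trans
      (mul_le_mul_of_nonneg_right (le_max_right _ _) (Real.exp_pos _).le)

/-- **The reduction: reflected antipodal mirror decay in the unit `a` implies `GapInUnits G r a`** (every compact
`G`, every `r`, every positive unit map with `a(β) → 0`; same rate `c₁`, threshold raised so that `β ≥ 0` and `a(β) ≤ 1`,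
same sizes; per-pair constant `max (Kref c₁ …) (2 a₀ b₀ e^{c₁ S_{AB}})`). -/
theorem gapInUnits_of_reflectedAntipodal (ha : ∀ β, 0 < a β) (ha0 : Tendsto a atTop (𝓝 0))
    (h : ReflectedAntipodalDecay G r a) :
    GapInUnits G r a := by
  obtain ⟨c₁, β₂, S₁, hc₁, hA⟩ := h
  -- eventually `a β ≤ 1`
  obtain ⟨βa, hβa⟩ : ∃ βa : ℝ, ∀ β, βa ≤ β → a β ≤ 1 := by
    have hev : ∀ᶠ β in atTop, a β < 1 := ha0.eventually (eventually_lt_nhds zero_lt_one)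
    obtain ⟨βa, h⟩ := Filter.eventually_atTop.1 hev
    exact ⟨βa, fun β hβ => (h β hβ).le⟩
  refine ⟨c₁, max (max β₂ βa) 0, S₁, hc₁, fun A B => ?_⟩
  obtain ⟨TA', TA, hsA⟩ := exists_isSlabSupported A
  obtain ⟨TB', TB, hsB⟩ := exists_isSlabSupported B
  obtain ⟨a0, ha0'⟩ := A.bounded
  obtain ⟨b0, hb0'⟩ := B.bounded
  obtain ⟨CA, hCA⟩ := hA A
  obtain ⟨CB, hCB⟩ := hA B
  set SAB : ℕ := 2 * (TA + TA' + TB + TB') + 2 with hSAB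
  refine ⟨max (Kref c₁ CA CB a0 b0 TA TB') (2 * (a0 * b0) * Real.exp (c₁ * SAB)), fun β hβ S n hS hn => ?_⟩
  have hβ2 : β₂ ≤ β := le_trans (le_max_left _ _) ((le_max_left _ _).trans hβ)
  have hβa' : βa ≤ β := le_trans (le_max_right _ _) ((le_max_left _ _).trans hβ)
  have hβ0 : 0 ≤ β := (le_max_right _ _).trans hβ
  have ha1 : a β ≤ 1 := hβa β hβa'
  have haβ : 0 ≤ a β := (ha β).le
  have hμ : 0 ≤ c₁ * a β := mul_nonneg hc₁.le haβ
  have hμ₀ : c₁ * a β ≤ c₁ := by nlinarith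
  have hexp0 : 0 ≤ Real.exp (-(c₁ * a β * n)) := (Real.exp_pos _).le
  by_cases hSl : SAB ≤ S
  · have key := abs_latticeConnectedCorr_le_of_reflected_uniform r.ρ r.continuous hβ0 hsA hsB ha0' hb0' hμ hμ₀
      CA CB hSl (hCA β hβ2 S hS).1 (hCA β hβ2 S hS).2 (hCB β hβ2 S hS).1 (hCB β hβ2 S hS).2 hn
    have e1 : Real.exp (-(c₁ * a β * (n : ℝ))) = Real.exp (-(c₁ * a β * n)) := rfl
    calc |latticeConnectedCorr r.ρ β (2 * S + 1) A.F B.F n|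
        ≤ Kref c₁ CA CB a0 b0 TA TB' * Real.exp (-(c₁ * a β * n)) := by simpa [mul_assoc] using key
      _ ≤ max (Kref c₁ CA CB a0 b0 TA TB') (2 * (a0 * b0) * Real.exp (c₁ * SAB)) * Real.exp (-(c₁ * a β * n)) :=
          mul_le_mul_of_nonneg_right (le_max_left _ _) hexp0
  · push Not at hSl
    have hsmall := abs_latticeConnectedCorr_le r.ρ r.continuous β S A B ha0' hb0' n
    have hab : 0 ≤ 2 * (a0 * b0) := (abs_nonneg _).trans hsmall
    -- `c₁ a β n ≤ c₁ S_{AB}` since `a β ≤ 1`, `n ≤ S < S_{AB}`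
    have hnS : (n : ℝ) ≤ SAB := by exact_mod_cast (hn.trans hSl.le)
    have h1 : 1 ≤ Real.exp (c₁ * SAB) * Real.exp (-(c₁ * a β * n)) := by
      rw [← Real.exp_add]
      apply Real.one_le_exp
      have h2 : c₁ * a β * (n : ℝ) ≤ c₁ * 1 * SAB := by
        have h3 : c₁ * a β * (n : ℝ) ≤ c₁ * a β * SAB := mul_le_mul_of_nonneg_left hnS hμ
        have h4 : c₁ * a β * (SAB : ℝ) ≤ c₁ * 1 * SAB :=
          mul_le_mul_of_nonneg_right (by nlinarith) (Nat.cast_nonneg _)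
        linarith
      linarith
    calc |latticeConnectedCorr r.ρ β (2 * S + 1) A.F B.F n|
        ≤ 2 * (a0 * b0) := hsmall
      _ ≤ 2 * (a0 * b0) * (Real.exp (c₁ * SAB) * Real.exp (-(c₁ * a β * n))) := le_mul_of_one_le_right hab h1
      _ = 2 * (a0 * b0) * Real.exp (c₁ * SAB) * Real.exp (-(c₁ * a β * n)) := by ring
      _ ≤ max (Kref c₁ CA CB a0 b0 TA TB') (2 * (a0 * b0) * Real.exp (c₁ * SAB)) * Real.exp (-(c₁ * a β * n)) :=
          mul_le_mul_of_nonneg_right (le_max_right _ _) hexp0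

/-- **`GapInUnits` is reflected antipodal mirror decay** (every compact `G`, `r`, unit map `a → 0`). -/
theorem gapInUnits_iff_reflectedAntipodal (ha : ∀ β, 0 < a β) (ha0 : Tendsto a atTop (𝓝 0)) :
    GapInUnits G r a ↔ ReflectedAntipodalDecay G r a :=
  ⟨reflectedAntipodal_of_gapInUnits, gapInUnits_of_reflectedAntipodal ha ha0⟩

end Equivalence

/-! ## §3 The crux and the residual of record, re-typed -/

/-- **`IRrefl` — `BalabanLadder.IR` with its conclusion restricted to the reflected mirror pairs at the antipode.** -/
def IRrefl : Prop :=
  ∀ (G : Type) [Group G] [TopologicalSpace G] [IsTopologicalGroup G] [CompactSpace G],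
    IsCompactSimpleLieGroup G →
    letI : MeasurableSpace G := borel G
    haveI : BorelSpace G := ⟨rfl⟩
    ∀ (r : LatticeRep G) (a : ℝ → ℝ), (∀ β, 0 < a β) → Tendsto a atTop (𝓝 0) → LowerBounds G r a →
      ReflectedAntipodalDecay G r a

/-- **`IRnscRefl` — the residual of record `IRnsc` (compact simple `G`, `π₁(G) ≠ 1`) in the same restricted form**
(= LINE E's token ANTI with both reflection orders). -/
def IRnscRefl : Prop :=
  ∀ (G : Type) [Group G] [TopologicalSpace G] [IsTopologicalGroup G] [CompactSpace G],
    IsCompactSimpleLieGroup G → ¬ SimplyConnectedSpace G →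
    letI : MeasurableSpace G := borel G
    haveI : BorelSpace G := ⟨rfl⟩
    ∀ (r : LatticeRep G) (a : ℝ → ℝ), (∀ β, 0 < a β) → Tendsto a atTop (𝓝 0) → LowerBounds G r a →
      ReflectedAntipodalDecay G r a

/-- **The crux `BalabanLadder.IR` (stmt-QuantumFields-19354) IS reflected antipodal mirror decay in floor units** (PROVED
equivalence; RP bookkeeping, no decay produced). -/
theorem IR_iff_reflected : Summit.QuantumFields.YangMills.Theses.BalabanLadder.IR ↔ IRrefl := by
  constructor
  · intro h G _ _ _ _ hG
    letI : MeasurableSpace G := borel G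
    haveI : BorelSpace G := ⟨rfl⟩
    intro r a ha ha0 hlb
    exact reflectedAntipodal_of_gapInUnits (h G hG r a ha ha0 hlb)
  · intro h G _ _ _ _ hG
    letI : MeasurableSpace G := borel G
    haveI : BorelSpace G := ⟨rfl⟩
    intro r a ha ha0 hlb
    exact gapInUnits_of_reflectedAntipodal ha ha0 (h G hG r a ha ha0 hlb)

/-- **The residual of record N (`IRnsc`) IS reflected antipodal mirror decay in floor units for `π₁(G) ≠ 1`** (PROVED
equivalence). -/
theorem IRnsc_iff_reflected : IRnsc ↔ IRnscRefl := by
  constructor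
  · intro h G _ _ _ _ hG hns
    letI : MeasurableSpace G := borel G
    haveI : BorelSpace G := ⟨rfl⟩
    intro r a ha ha0 hlb
    exact reflectedAntipodal_of_gapInUnits (h G hG hns r a ha ha0 hlb)
  · intro h G _ _ _ _ hG hns
    letI : MeasurableSpace G := borel G
    haveI : BorelSpace G := ⟨rfl⟩
    intro r a ha ha0 hlb
    exact gapInUnits_of_reflectedAntipodal ha ha0 (h G hG hns r a ha ha0 hlb)

end Summit.QuantumFields.YangMills.Cruxes.IR.ReflectedAntipodal

end
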